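import Mathlib.Analysis.SpecialFunctions.Exponential
import Mathlib.Analysis.Complex.Basic
import Mathlib.Data.Matrix.Mul
import Mathlib.Data.Finset.NAry
import HarnessLib

/-!
# The frequency spectrum of a data-encoding ("re-uploading") quantum model is fixed by the encoding eigenvalues

Schuld, Sweke, Meyer, *Effect of data encoding on the expressive power of variational
quantum-machine-learning models*, Phys. Rev. A **103**, 032430 (2021) = arXiv:2008.08605, §II
("Quantum models as partial Fourier series"), eqs. (3)–(12), and §III.A–B.  (Equation numbers follow the
arXiv / journal counter, in which eqs. (1)–(2) are the multivariate sums of §I; the five docstring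
numbers that had counted from the model were shifted by +2 at the referee's request LEAN-DES-R1.)

A (univariate) *quantum model* is `f(x) = ⟨ψ| U(x)† M U(x) |ψ⟩` (eq. (3)) with the layered circuit
`U(x) = W^{(L+1)} S(x) W^{(L)} ⋯ W^{(2)} S(x) W^{(1)}` (eq. (4)), where every data-encoding block is
`S(x) = e^{-ixH}` and, after absorbing the diagonalising unitaries of `H` into the trainable blocks,
`H = diag(λ₁, …, λ_d)` WLOG (§II, first step).  The paper's basic tool (eqs. (10)–(12)) is that
`f` is a finite exponential sum
`f(x) = ∑_{ω ∈ Ω} c_ω e^{iωx}`,  `Ω = {Λ_k − Λ_j : k, j ∈ [d]^L}`,  `Λ_j = λ_{j₁} + ⋯ + λ_{j_L}`,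
i.e. the *frequency spectrum* `Ω` is determined by the encoding eigenvalues alone, while the
trainable blocks and the observable only choose the coefficients `c_ω`; `0 ∈ Ω`, `Ω = −Ω`
(p. 5 of the arXiv version), and repeating a Pauli-type encoding `L` times in sequence can only
extend the spectrum linearly in `L` (§III.B: the degree of the truncated Fourier series is `≤ r = L`
for eigenvalues `±½`; §III.A: a single Pauli encoding gives the single frequency `|ω| = 1`).

What is formalised (all PROVED, no named facts):

* `IsExpSum S g` — `g : ℝ → ℂ` is an exponential sum with frequencies in the finite set `S ⊆ ℝ`,
  and its closure under constants, sums, scalar multiples, products (frequencies add: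
  `Finset.image₂ (· + ·)`) and complex conjugation (frequencies negate) [folklore];
* the model itself: `encode lam x = diagonal (e^{-i λ_j x})` (= `e^{-ixH}` for diagonal `H`),
  `circuit lam W L x` (eq. (4) with `L` encoding blocks and trainable blocks `W 0, …, W L`, arbitrary
  `d × d` complex matrices — unitarity is never used, exactly as the paper notes: "we have not
  assumed anything about … the nature of the unitaries `W`, or the measurement `M`", §III.A),
  `model lam W M ψ L x = star (U ψ) ⬝ᵥ (M *ᵥ (U ψ))` (eq. (3) with an arbitrary initial vector);
* `eigSums lam L` = the finite set `{Λ_j}` of `L`-fold sums of encoding eigenvalues and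
  `freqSpectrum lam L = image₂ (· − ·) (eigSums lam L) (eigSums lam L)` = `Ω` of eq. (10);
* `circuit_apply_isExpSum` (eq. (7): every amplitude of `U(x)` is an exponential sum with
  frequencies `−Λ_j`), `model_isExpSum` (eqs. (10)–(12): `f` is an exponential sum over `Ω`),
  `zero_mem_freqSpectrum`, `neg_mem_freqSpectrum` (p. 5), and the linear degree bound
  `abs_le_of_mem_freqSpectrum`: `|λ_j| ≤ γ` for all `j` ⇒ `|ω| ≤ 2Lγ` on `Ω` (§III.B upper bound;
  for Pauli rotations `γ = ½` this is `|ω| ≤ L`).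

Deliberately NOT here: the converse statements of §III.B (that *every* integer in `[-L, L]` occurs
and that the coefficients can be chosen freely enough for universality, §IV), the multivariate
version (Appendix A of the paper), shot noise, and any cost / complexity bookkeeping.  The lane
pub-qadeq cites this file when a "quantum neural network" evaluated by state-vector simulation is
typed as a classical trigonometric-polynomial feature model (CLAIMS rows A-37, A-247, A-258).
-/

namespace Literature.Computability.QuantumComplexity.DataEncodingSpectrum

open Finset Matrix
open scoped BigOperators ComplexConjugate

noncomputable section

/-! ## Exponential sums with a prescribed finite frequency set -/

/-- The Fourier mode `e ω x = exp(i ω x)` for real frequency `ω` and real input `x`. [folklore] -/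
def e (ω x : ℝ) : ℂ := Complex.exp (Complex.I * ω * x)

/-- `e 0 x = 1`. [folklore] -/
private theorem e_zero (x : ℝ) : e 0 x = 1 := by simp [e]

/-- Frequencies add under multiplication: `e (ω+ν) x = e ω x * e ν x`. [folklore] -/
private theorem e_add (ω ν x : ℝ) : e (ω + ν) x = e ω x * e ν x := by
  simp only [e, ← Complex.exp_add]
  congr 1
  push_cast
  ring

/-- Complex conjugation negates the frequency: `conj (e ω x) = e (-ω) x`. [folklore] -/
private theorem conj_e (ω x : ℝ) : conj (e ω x) = e (-ω) x := by
  simp only [e, ← Complex.exp_conj, map_mul, Complex.conj_I, Complex.conj_ofReal]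
  congr 1
  push_cast
  ring

/-- `IsExpSum S g`: the function `g : ℝ → ℂ` is a finite exponential sum
`g(x) = ∑_{ω ∈ S} c_ω e^{iωx}` with (real) frequencies in the finite set `S` — the shape of
eq. (5)/(11) of Schuld–Sweke–Meyer ("f(x) = Σ_{ω∈Ω} c_ω e^{iωx}"); for integer `S` this is a partial
Fourier series. [cite: SchuldSwekeMeyer2021, §II eqs. (5) and (11)] -/
def IsExpSum (S : Finset ℝ) (g : ℝ → ℂ) : Prop :=
  ∃ c : ℝ → ℂ, ∀ x : ℝ, g x = ∑ ω ∈ S, c ω * e ω x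

namespace IsExpSum

variable {S T : Finset ℝ} {g h : ℝ → ℂ}

/-- Pointwise-equal functions have the same exponential-sum structure. [folklore] -/
private theorem congr {f : ℝ → ℂ} (hg : IsExpSum S g) (hfg : ∀ x, f x = g x) : IsExpSum S f := by
  obtain ⟨c, hc⟩ := hg
  exact ⟨c, fun x => by rw [hfg x, hc x]⟩

/-- Enlarging the frequency set (coefficients extended by zero). [folklore] -/
private theorem mono (hg : IsExpSum S g) (hST : S ⊆ T) : IsExpSum T g := by
  classical
  obtain ⟨c, hc⟩ := hg
  refine ⟨fun ω => if ω ∈ S then c ω else 0, fun x => ?_⟩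
  dsimp only
  rw [hc x]
  rw [← Finset.sum_subset hST (f := fun ω => (if ω ∈ S then c ω else 0) * e ω x)]
  · exact Finset.sum_congr rfl fun ω hω => by simp [hω]
  · intro ω _ hω
    simp [hω]

/-- The zero function is an exponential sum over any frequency set. [folklore] -/
private theorem zero (S : Finset ℝ) : IsExpSum S (fun _ => 0) :=
  ⟨fun _ => 0, fun x => by simp⟩

/-- A constant is an exponential sum with the single frequency `0`. [folklore] -/
private theorem const (a : ℂ) : IsExpSum {0} (fun _ => a) :=
  ⟨fun _ => a, fun x => by simp [e_zero]⟩

/-- A single mode `a · e^{iωx}`. [folklore] -/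
private theorem single (a : ℂ) (ω : ℝ) : IsExpSum {ω} (fun x => a * e ω x) :=
  ⟨fun _ => a, fun x => by simp⟩

/-- Closure under addition (same frequency set). [folklore] -/
private theorem add (hg : IsExpSum S g) (hh : IsExpSum S h) : IsExpSum S (fun x => g x + h x) := by
  obtain ⟨c, hc⟩ := hg
  obtain ⟨c', hc'⟩ := hh
  refine ⟨fun ω => c ω + c' ω, fun x => ?_⟩
  dsimp only
  rw [hc x, hc' x, ← Finset.sum_add_distrib]
  exact Finset.sum_congr rfl fun ω _ => by ring

/-- Closure under scalar multiplication. [folklore] -/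
private theorem smul (a : ℂ) (hg : IsExpSum S g) : IsExpSum S (fun x => a * g x) := by
  obtain ⟨c, hc⟩ := hg
  refine ⟨fun ω => a * c ω, fun x => ?_⟩
  dsimp only
  rw [hc x, Finset.mul_sum]
  exact Finset.sum_congr rfl fun ω _ => by ring

/-- Closure under multiplication on the right by a constant. [folklore] -/
private theorem mul_const (a : ℂ) (hg : IsExpSum S g) : IsExpSum S (fun x => g x * a) :=
  (hg.smul a).congr fun x => by ring

/-- Closure under finite sums (same frequency set). [folklore] -/
private theorem sum {ι : Type*} (s : Finset ι) {G : ι → ℝ → ℂ} (hG : ∀ i, IsExpSum S (G i)) :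
    IsExpSum S (fun x => ∑ i ∈ s, G i x) := by
  choose c hc using hG
  refine ⟨fun ω => ∑ i ∈ s, c i ω, fun x => ?_⟩
  dsimp only
  simp_rw [hc]
  rw [Finset.sum_comm]
  exact Finset.sum_congr rfl fun ω _ => by rw [Finset.sum_mul]

/-- Closure under products: frequencies ADD, `Ω_{gh} ⊆ Ω_g + Ω_h` — the step of the derivation
eqs. (8)–(10) by which `e^{-iΛ_j x}` arises as a product of `L` factors `e^{-iλ x}` and `f` collects the
frequencies `Λ_k − Λ_j`. [cite: SchuldSwekeMeyer2021, §II eqs. (8)–(10)] -/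
theorem mul (hg : IsExpSum S g) (hh : IsExpSum T h) :
    IsExpSum (image₂ (· + ·) S T) (fun x => g x * h x) := by
  classical
  obtain ⟨c, hc⟩ := hg
  obtain ⟨c', hc'⟩ := hh
  refine ⟨fun μ => ∑ p ∈ (S ×ˢ T).filter (fun p => p.1 + p.2 = μ), c p.1 * c' p.2, fun x => ?_⟩
  dsimp only
  rw [hc x, hc' x]
  calc (∑ ω ∈ S, c ω * e ω x) * ∑ ν ∈ T, c' ν * e ν x
      = ∑ ω ∈ S, ∑ ν ∈ T, c ω * e ω x * (c' ν * e ν x) := Finset.sum_mul_sum _ _ _ _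
    _ = ∑ p ∈ S ×ˢ T, c p.1 * e p.1 x * (c' p.2 * e p.2 x) :=
        (Finset.sum_product' S T (fun ω ν => c ω * e ω x * (c' ν * e ν x))).symm
    _ = ∑ p ∈ S ×ˢ T, c p.1 * c' p.2 * e (p.1 + p.2) x :=
        Finset.sum_congr rfl fun p _ => by rw [e_add]; ring
    _ = ∑ μ ∈ image₂ (· + ·) S T,
          ∑ p ∈ (S ×ˢ T).filter (fun p => p.1 + p.2 = μ), c p.1 * c' p.2 * e (p.1 + p.2) x := by
        symm
        apply Finset.sum_fiberwise_of_maps_to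
        intro p hp
        rw [Finset.mem_product] at hp
        exact Finset.mem_image₂_of_mem hp.1 hp.2
    _ = ∑ μ ∈ image₂ (· + ·) S T,
          (∑ p ∈ (S ×ˢ T).filter (fun p => p.1 + p.2 = μ), c p.1 * c' p.2) * e μ x := by
        refine Finset.sum_congr rfl fun μ _ => ?_
        rw [Finset.sum_mul]
        refine Finset.sum_congr rfl fun p hp => ?_
        rw [(Finset.mem_filter.mp hp).2]

/-- Closure under complex conjugation: frequencies NEGATE — the `Λ_k` half of `Λ_k − Λ_j` in
eq. (10) comes from the conjugated amplitude ("we need to take into account the complex conjugation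
of this expression as well as the measurement", §II before eq. (10)).
[cite: SchuldSwekeMeyer2021, §II eq. (10)] -/
theorem cconj (hg : IsExpSum S g) : IsExpSum (S.image Neg.neg) (fun x => conj (g x)) := by
  classical
  obtain ⟨c, hc⟩ := hg
  refine ⟨fun ω => conj (c (-ω)), fun x => ?_⟩
  dsimp only
  rw [hc x, map_sum, Finset.sum_image (fun a _ b _ h => neg_injective h)]
  refine Finset.sum_congr rfl fun ω _ => ?_
  rw [map_mul, conj_e, neg_neg]

end IsExpSum

/-! ## The data-encoding circuit of Schuld–Sweke–Meyer eq. (4) -/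

variable {d : ℕ}

/-- The data-encoding block `S(x) = e^{-ixH}` for the diagonal encoding Hamiltonian
`H = diag(λ₁,…,λ_d)` (WLOG diagonal: "we can 'absorb' `V, V†` into the arbitrary unitaries", §II):
`S(x) = diag(e^{-iλ_j x})`. [cite: SchuldSwekeMeyer2021, §II eq. (4) and the first step after eq. (5)] -/
def encode (lam : Fin d → ℝ) (x : ℝ) : Matrix (Fin d) (Fin d) ℂ :=
  Matrix.diagonal fun j => e (-lam j) x

/-- The layered circuit of eq. (4) with `L` encoding blocks:
`circuit lam W L x = W L · S(x) · W (L-1) · ⋯ · S(x) · W 0` (so `W 0 = W^{(1)}`, …,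
`W L = W^{(L+1)}` in the paper's numbering); the trainable blocks are arbitrary `d × d` complex
matrices (only blocks `W 0, …, W L` are used). [cite: SchuldSwekeMeyer2021, §II eq. (4)] -/
def circuit (lam : Fin d → ℝ) (W : ℕ → Matrix (Fin d) (Fin d) ℂ) :
    ℕ → ℝ → Matrix (Fin d) (Fin d) ℂ
  | 0 => fun _ => W 0
  | L + 1 => fun x => W (L + 1) * encode lam x * circuit lam W L x

/-- The quantum model of eq. (3): `f(x) = ⟨ψ| U(x)† M U(x) |ψ⟩` with `U = circuit lam W L`,
observable `M` and initial vector `ψ` (the paper takes `ψ = |0⟩`; nothing below depends on it).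
[cite: SchuldSwekeMeyer2021, §II eq. (3)] -/
def model (lam : Fin d → ℝ) (W : ℕ → Matrix (Fin d) (Fin d) ℂ) (M : Matrix (Fin d) (Fin d) ℂ)
    (ψ : Fin d → ℂ) (L : ℕ) (x : ℝ) : ℂ :=
  star (circuit lam W L x *ᵥ ψ) ⬝ᵥ (M *ᵥ (circuit lam W L x *ᵥ ψ))

/-- The finite set of `L`-fold eigenvalue sums `{Λ_j = λ_{j₁} + ⋯ + λ_{j_L} : j ∈ [d]^L}`,
built recursively (`{0}` for `L = 0`). [cite: SchuldSwekeMeyer2021, §II before eq. (7)] -/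
def eigSums (lam : Fin d → ℝ) : ℕ → Finset ℝ
  | 0 => {0}
  | L + 1 => image₂ (· + ·) (eigSums lam L) (univ.image lam)

/-- The frequency spectrum `Ω = {Λ_k − Λ_j : k, j ∈ [d]^L}` of eq. (10).
[cite: SchuldSwekeMeyer2021, §II eq. (10)] -/
def freqSpectrum (lam : Fin d → ℝ) (L : ℕ) : Finset ℝ :=
  image₂ (fun a b => a - b) (eigSums lam L) (eigSums lam L)

variable (lam : Fin d → ℝ) (W : ℕ → Matrix (Fin d) (Fin d) ℂ)

/-- Unfolding one layer entrywise: `(W_{L+1} S(x) U_L(x))_{ik} = ∑_m U_L(x)_{mk} (W_{L+1,im} e^{-iλ_m x})`.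
[cite: SchuldSwekeMeyer2021, §II eq. (6)–(7)] -/
theorem circuit_succ_apply (L : ℕ) (x : ℝ) (i k : Fin d) :
    circuit lam W (L + 1) x i k =
      ∑ m, circuit lam W L x m k * (W (L + 1) i m * e (-lam m) x) := by
  show (W (L + 1) * encode lam x * circuit lam W L x) i k = _
  rw [Matrix.mul_apply]
  refine Finset.sum_congr rfl fun m _ => ?_
  simp only [encode, Matrix.mul_diagonal]
  ring

/-- `-(eigSums (L+1)) = (-(eigSums L)) + (-(spectrum of H))` as finite sets. [folklore] -/
private theorem image_neg_eigSums_succ (L : ℕ) :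
    (eigSums lam (L + 1)).image Neg.neg =
      image₂ (· + ·) ((eigSums lam L).image Neg.neg) ((univ.image lam).image Neg.neg) := by
  show (image₂ (· + ·) (eigSums lam L) (univ.image lam)).image Neg.neg = _
  exact Finset.image_image₂_distrib fun a b => neg_add a b

/-- Eq. (7): every matrix element of `U_L(x)` is an exponential sum whose frequencies are the
negated eigenvalue sums `−Λ_j`, `j ∈ [d]^L`.
[cite: SchuldSwekeMeyer2021, §II eq. (7)] -/
theorem circuit_apply_isExpSum :
    ∀ (L : ℕ) (i k : Fin d),
      IsExpSum ((eigSums lam L).image Neg.neg) (fun x => circuit lam W L x i k)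
  | 0, i, k => by
      have h0 : ((eigSums lam 0).image Neg.neg) = ({0} : Finset ℝ) := by
        show (({0} : Finset ℝ).image Neg.neg) = {0}
        simp
      rw [h0]
      exact (IsExpSum.const (W 0 i k)).congr fun x => rfl
  | L + 1, i, k => by
      have hsub : ∀ m : Fin d,
          image₂ (· + ·) ((eigSums lam L).image Neg.neg) ({-lam m} : Finset ℝ) ⊆
            (eigSums lam (L + 1)).image Neg.neg := by
        intro m
        rw [image_neg_eigSums_succ]
        refine Finset.image₂_subset subset_rfl ?_
        rw [Finset.singleton_subset_iff, Finset.mem_image]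
        exact ⟨lam m, Finset.mem_image_of_mem lam (Finset.mem_univ m), rfl⟩
      have h : IsExpSum ((eigSums lam (L + 1)).image Neg.neg)
          (fun x => ∑ m, circuit lam W L x m k * (W (L + 1) i m * e (-lam m) x)) :=
        IsExpSum.sum _ fun m =>
          ((circuit_apply_isExpSum L m k).mul (IsExpSum.single (W (L + 1) i m) (-lam m))).mono
            (hsub m)
      exact h.congr fun x => circuit_succ_apply lam W L x i k

/-- Every amplitude `(U_L(x) ψ)_i` is an exponential sum with frequencies `−Λ_j`.
[cite: SchuldSwekeMeyer2021, §II eq. (7)] -/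
theorem mulVec_isExpSum (ψ : Fin d → ℂ) (L : ℕ) (i : Fin d) :
    IsExpSum ((eigSums lam L).image Neg.neg) (fun x => (circuit lam W L x *ᵥ ψ) i) := by
  have h : IsExpSum ((eigSums lam L).image Neg.neg)
      (fun x => ∑ k, circuit lam W L x i k * ψ k) :=
    IsExpSum.sum _ fun k => (circuit_apply_isExpSum lam W L i k).mul_const (ψ k)
  exact h.congr fun x => by simp [Matrix.mulVec, dotProduct]

/-- `Ω` rewritten as a sumset: `{Λ_k} + (−{Λ_j}) = {Λ_k − Λ_j}`. [folklore] -/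
private theorem image₂_add_image_neg_eq_freqSpectrum (L : ℕ) :
    image₂ (· + ·) (eigSums lam L) ((eigSums lam L).image Neg.neg) = freqSpectrum lam L := by
  rw [Finset.image₂_image_right]
  simp only [freqSpectrum, ← sub_eq_add_neg]

/-- `−(−S) = S` for finite sets of reals. [folklore] -/
private theorem image_neg_image_neg (S : Finset ℝ) : (S.image Neg.neg).image Neg.neg = S := by
  simp [Finset.image_image]

/-- **Schuld–Sweke–Meyer, eqs. (10)–(12).** The quantum model `f(x) = ⟨ψ|U(x)† M U(x)|ψ⟩` of a circuit
with `L` diagonal data-encoding blocks `e^{-ix diag(λ)}` interleaved with arbitrary trainable blocks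
is a finite exponential sum `f(x) = ∑_{ω ∈ Ω} c_ω e^{iωx}` whose frequency spectrum
`Ω = {Λ_k − Λ_j}` depends ONLY on the encoding eigenvalues; the trainable blocks `W`, the observable
`M` and the input state only enter the coefficients.
[cite: SchuldSwekeMeyer2021, §II eqs. (10)–(12)] -/
theorem model_isExpSum (M : Matrix (Fin d) (Fin d) ℂ) (ψ : Fin d → ℂ) (L : ℕ) :
    IsExpSum (freqSpectrum lam L) (model lam W M ψ L) := by
  have hamp := mulVec_isExpSum lam W ψ L
  -- the conjugated amplitudes carry the frequencies `+Λ_k`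
  have hconj : ∀ i, IsExpSum (eigSums lam L) (fun x => conj ((circuit lam W L x *ᵥ ψ) i)) := by
    intro i
    have h := (hamp i).cconj
    rwa [image_neg_image_neg] at h
  -- the `M`-rotated amplitudes carry the frequencies `−Λ_j`
  have hM : ∀ i, IsExpSum ((eigSums lam L).image Neg.neg)
      (fun x => (M *ᵥ (circuit lam W L x *ᵥ ψ)) i) := by
    intro i
    have h : IsExpSum ((eigSums lam L).image Neg.neg)
        (fun x => ∑ i', M i i' * (circuit lam W L x *ᵥ ψ) i') :=
      IsExpSum.sum _ fun i' => (hamp i').smul (M i i')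
    exact h.congr fun x => by simp only [Matrix.mulVec, dotProduct]
  have h : IsExpSum (freqSpectrum lam L)
      (fun x => ∑ i, conj ((circuit lam W L x *ᵥ ψ) i) * (M *ᵥ (circuit lam W L x *ᵥ ψ)) i) := by
    rw [← image₂_add_image_neg_eq_freqSpectrum]
    exact IsExpSum.sum _ fun i => (hconj i).mul (hM i)
  exact h.congr fun x => by
    simp only [model, dotProduct, Pi.star_apply, Complex.star_def]

/-! ## Structural properties of `Ω` (p. 5) and the linear degree bound (§III.B) -/

/-- `eigSums` is nonempty as soon as there is at least one encoding eigenvalue. [folklore] -/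
private theorem eigSums_nonempty (hd : 0 < d) : ∀ L : ℕ, (eigSums lam L).Nonempty
  | 0 => by
      show (({0} : Finset ℝ)).Nonempty
      exact Finset.singleton_nonempty 0
  | L + 1 => by
      show (image₂ (· + ·) (eigSums lam L) (univ.image lam)).Nonempty
      refine Finset.image₂_nonempty_iff.mpr ⟨eigSums_nonempty hd L, ?_⟩
      exact (Finset.univ_nonempty_iff.mpr ⟨⟨0, hd⟩⟩).image lam

/-- `0 ∈ Ω` ("the frequency spectrum Ω has the following important properties: 0 ∈ Ω", p. 5).
[cite: SchuldSwekeMeyer2021, §II after eq. (10)] -/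
theorem zero_mem_freqSpectrum (hd : 0 < d) (L : ℕ) : (0 : ℝ) ∈ freqSpectrum lam L := by
  obtain ⟨a, ha⟩ := eigSums_nonempty lam hd L
  exact Finset.mem_image₂.mpr ⟨a, ha, a, ha, sub_self a⟩

/-- `Ω = −Ω` ("for every frequency ω ∈ Ω, we have also that −ω ∈ Ω", p. 5).
[cite: SchuldSwekeMeyer2021, §II after eq. (10)] -/
theorem neg_mem_freqSpectrum (L : ℕ) {ω : ℝ} (hω : ω ∈ freqSpectrum lam L) :
    -ω ∈ freqSpectrum lam L := by
  obtain ⟨a, ha, b, hb, rfl⟩ := Finset.mem_image₂.mp hω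
  exact Finset.mem_image₂.mpr ⟨b, hb, a, ha, (neg_sub a b).symm⟩

/-- If every encoding eigenvalue satisfies `|λ_j| ≤ γ`, every `L`-fold sum satisfies `|Λ_j| ≤ Lγ`.
[folklore] -/
private theorem abs_le_of_mem_eigSums {γ : ℝ} (hγ : ∀ j, |lam j| ≤ γ) :
    ∀ (L : ℕ) {a : ℝ}, a ∈ eigSums lam L → |a| ≤ L * γ
  | 0, a, ha => by
      have : a = 0 := by simpa [eigSums] using ha
      simp [this]
  | L + 1, a, ha => by
      have ha' : a ∈ image₂ (· + ·) (eigSums lam L) (univ.image lam) := ha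
      obtain ⟨b, hb, c, hc, rfl⟩ := Finset.mem_image₂.mp ha'
      obtain ⟨j, -, rfl⟩ := Finset.mem_image.mp hc
      have hb' := abs_le_of_mem_eigSums hγ L hb
      calc |b + lam j| ≤ |b| + |lam j| := abs_add_le _ _
        _ ≤ L * γ + γ := add_le_add hb' (hγ j)
        _ = (↑(L + 1) : ℝ) * γ := by push_cast; ring

/-- **Linear growth of the spectrum with the number of encoding repetitions** (§III.B, upper-bound
half: "one can systematically increase the degree of the truncated Fourier series to r" by repeating
the encoding `r = L` times; §III.A: a single encoding with eigenvalues `±γ` has `Ω = {−2γ, 0, 2γ}`).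
If `|λ_j| ≤ γ` for all `j` then every frequency of the `L`-layer model satisfies `|ω| ≤ 2Lγ`; for
Pauli-rotation encodings (`γ = ½`) the model is a trigonometric polynomial of degree `≤ L`.
[cite: SchuldSwekeMeyer2021, §III.A–B] -/
theorem abs_le_of_mem_freqSpectrum {γ : ℝ} (hγ : ∀ j, |lam j| ≤ γ) (L : ℕ) {ω : ℝ}
    (hω : ω ∈ freqSpectrum lam L) : |ω| ≤ 2 * L * γ := by
  obtain ⟨a, ha, b, hb, rfl⟩ := Finset.mem_image₂.mp hω
  calc |a - b| = |a + -b| := by rw [sub_eq_add_neg]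
    _ ≤ |a| + |-b| := abs_add_le _ _
    _ = |a| + |b| := by rw [abs_neg]
    _ ≤ L * γ + L * γ := add_le_add (abs_le_of_mem_eigSums lam hγ L ha)
        (abs_le_of_mem_eigSums lam hγ L hb)
    _ = 2 * L * γ := by ring

/-- Pauli-rotation corollary (§III.B with `γ = ½`): if every encoding eigenvalue is `±½` (as for
`H = σ/2`, `σ ∈ {X, Y, Z}`), the `L`-layer re-uploading model has all frequencies in `[-L, L]`.
[cite: SchuldSwekeMeyer2021, §III.B] -/
theorem abs_le_of_mem_freqSpectrum_pauli (hlam : ∀ j, lam j = 1 / 2 ∨ lam j = -(1 / 2)) (L : ℕ)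
    {ω : ℝ} (hω : ω ∈ freqSpectrum lam L) : |ω| ≤ L := by
  have hγ : ∀ j, |lam j| ≤ 1 / 2 := by
    intro j
    rcases hlam j with h | h <;> rw [h] <;> norm_num
  have := abs_le_of_mem_freqSpectrum lam hγ L hω
  linarith


/-! ## The sequential Pauli-encoding spectrum is exactly `{-L, …, L}` (§III.B)

Schuld–Sweke–Meyer, §III.B ("Repeated Pauli encodings linearly extend the frequency spectrum"):
for `r` repetitions of a single-qubit Pauli-rotation encoding (eigenvalues `±½` of `σ/2`) the spectrum is
`Ω_par = {λ_{k₁} − λ_{j₁}} = {−r, −(r−1), …, 0, …, r−1, r}` and "after a short calculation, one finds that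
`Ω_seq = Ω_par`. Again, a quantum model with `r` sequential repetitions of the single-qubit Pauli encoding
can be expressed as a truncated Fourier series of degree `r`."  Below: the SEQUENTIAL statement for the
`d = 2` encoding `pauliEig = (½, −½)` with `L` encoding blocks — the `L`-fold eigenvalue sums are
`{k − L/2 : k = 0, …, L}` and the frequency spectrum is exactly the set of integers in `[−L, L]`
(both inclusions; the inclusion `⊆` alone is `abs_le_of_mem_freqSpectrum_pauli` above). -/

/-- The two eigenvalues `+½, −½` of a Pauli-rotation generator `σ/2`, as an encoding spectrum on
`Fin 2`. [cite: SchuldSwekeMeyer2021, §III.A ("we can without loss of generality always rescale the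
energy spectrum to (−γ, γ) … Pauli rotations, γ = 1/2")] -/
def pauliEig : Fin 2 → ℝ := fun j => if j = 0 then 1 / 2 else -(1 / 2)

/-- The encoding spectrum of `pauliEig` as a finite set: `{½, −½}`. [folklore] -/
private theorem univ_image_pauliEig :
    (univ : Finset (Fin 2)).image pauliEig = {(1 / 2 : ℝ), -(1 / 2)} := by
  ext x
  simp only [mem_image, mem_univ, true_and, mem_insert, mem_singleton, pauliEig, Fin.exists_fin_two,
    Fin.isValue, if_true, show (1 : Fin 2) ≠ 0 from by decide, if_false]
  constructor
  · rintro (h | h) <;> simp [← h]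
  · rintro (h | h)
    · exact Or.inl h.symm
    · exact Or.inr h.symm

/-- The `L`-fold sums of Pauli eigenvalues are `{k − L/2 : k = 0, …, L}`.
[cite: SchuldSwekeMeyer2021, §III.B (the sums `λ_{k₁} + ⋯ + λ_{k_r}` in `Ω_seq`)] -/
theorem eigSums_pauliEig (L : ℕ) :
    eigSums pauliEig L = (range (L + 1)).image (fun k : ℕ => (k : ℝ) - L / 2) := by
  induction L with
  | zero =>
    ext x
    simp [eigSums]
  | succ L ih =>
    rw [eigSums, ih, univ_image_pauliEig]
    ext ω
    simp only [mem_image₂, mem_image, mem_range, mem_insert, mem_singleton]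
    constructor
    · rintro ⟨a, ⟨k, hk, rfl⟩, b, hb, rfl⟩
      rcases hb with rfl | rfl
      · exact ⟨k + 1, by omega, by push_cast; ring⟩
      · exact ⟨k, by omega, by push_cast; ring⟩
    · rintro ⟨k, hk, rfl⟩
      rcases Nat.eq_zero_or_pos k with rfl | hk0
      · exact ⟨(0 : ℕ) - (L : ℝ) / 2, ⟨0, by omega, rfl⟩, -(1 / 2), Or.inr rfl, by push_cast; ring⟩
      · refine ⟨((k - 1 : ℕ) : ℝ) - (L : ℝ) / 2, ⟨k - 1, by omega, rfl⟩, 1 / 2, Or.inl rfl, ?_⟩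
        rw [Nat.cast_sub (by omega : 1 ≤ k)]
        push_cast
        ring

/-- **§III.B, sequential Pauli encodings, exact spectrum.**  For `L` sequential single-qubit
Pauli-rotation encodings the frequency spectrum is EXACTLY the set of integers `{−L, …, L}`:
`Ω_seq = Ω_par = {−r, −(r−1), …, 0, …, r−1, r}` with `r = L`
("a quantum model with r sequential repetitions of the single-qubit Pauli encoding can be expressed
as a truncated Fourier series of degree r").  [cite: SchuldSwekeMeyer2021, §III.B] -/
theorem freqSpectrum_pauliEig (L : ℕ) :
    freqSpectrum pauliEig L = (Icc (-(L : ℤ)) L).image (fun z : ℤ => (z : ℝ)) := by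
  rw [freqSpectrum, eigSums_pauliEig]
  ext ω
  simp only [mem_image₂, mem_image, mem_range, mem_Icc]
  constructor
  · rintro ⟨a, ⟨k, hk, rfl⟩, b, ⟨k', hk', rfl⟩, rfl⟩
    exact ⟨(k : ℤ) - k', ⟨by omega, by omega⟩, by push_cast; ring⟩
  · rintro ⟨z, ⟨hz1, hz2⟩, rfl⟩
    rcases le_or_gt 0 z with hz | hz
    · refine ⟨((z.toNat : ℕ) : ℝ) - (L : ℝ) / 2, ⟨z.toNat, by omega, rfl⟩,
        ((0 : ℕ) : ℝ) - (L : ℝ) / 2, ⟨0, by omega, rfl⟩, ?_⟩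
      have h : ((z.toNat : ℕ) : ℤ) = z := Int.toNat_of_nonneg hz
      have h' : ((z.toNat : ℕ) : ℝ) = (z : ℝ) := by exact_mod_cast h
      rw [h']
      push_cast
      ring
    · refine ⟨((0 : ℕ) : ℝ) - (L : ℝ) / 2, ⟨0, by omega, rfl⟩,
        (((-z).toNat : ℕ) : ℝ) - (L : ℝ) / 2, ⟨(-z).toNat, by omega, rfl⟩, ?_⟩
      have h : (((-z).toNat : ℕ) : ℤ) = -z := Int.toNat_of_nonneg (by omega)
      have h' : (((-z).toNat : ℕ) : ℝ) = -(z : ℝ) := by exact_mod_cast h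
      rw [h']
      push_cast
      ring

/-- Membership form of `freqSpectrum_pauliEig`: `ω ∈ Ω` iff `ω` is an integer of absolute value
at most `L` — in particular every such integer frequency IS attained (the converse of
`abs_le_of_mem_freqSpectrum_pauli`). [cite: SchuldSwekeMeyer2021, §III.B] -/
theorem mem_freqSpectrum_pauliEig_iff (L : ℕ) (ω : ℝ) :
    ω ∈ freqSpectrum pauliEig L ↔ ∃ z : ℤ, |z| ≤ L ∧ ω = z := by
  rw [freqSpectrum_pauliEig]
  simp only [mem_image, mem_Icc, abs_le]
  constructor
  · rintro ⟨z, hz, rfl⟩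
    exact ⟨z, hz, rfl⟩
  · rintro ⟨z, hz, rfl⟩
    exact ⟨z, hz, rfl⟩

/-- The degree (largest frequency) of the `L`-block Pauli model is exactly `L`: `(L : ℝ) ∈ Ω`.
[cite: SchuldSwekeMeyer2021, §III.B ("truncated Fourier series of degree r")] -/
theorem natCast_mem_freqSpectrum_pauliEig (L : ℕ) : (L : ℝ) ∈ freqSpectrum pauliEig L :=
  (mem_freqSpectrum_pauliEig_iff L L).2 ⟨L, by simp, by simp⟩

/-! ## Counting the frequencies (§III.B: `Ω = {−r, …, r}` has `2r + 1` elements, from `r + 1` sums) -/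

/-- The `L`-fold Pauli eigenvalue sums `{k − L/2 : k = 0, …, L}` are `L + 1` distinct reals.
[cite: SchuldSwekeMeyer2021, §III.B (the `r + 1` values of `λ_{k₁} + ⋯ + λ_{k_r}`)] -/
theorem card_eigSums_pauliEig (L : ℕ) : (eigSums pauliEig L).card = L + 1 := by
  rw [eigSums_pauliEig, card_image_of_injective _ _, card_range]
  intro a b h
  have h' : (a : ℝ) = b := by simpa using h
  exact_mod_cast h'

/-- The frequency spectrum of `L` sequential Pauli encodings, `Ω = {−L, …, L}`, consists of exactly
`2L + 1` integer frequencies — the size of the accessible truncated Fourier series of degree `L`.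
[cite: SchuldSwekeMeyer2021, §III.B (`Ω_seq = {−r, …, r}`)] -/
theorem card_freqSpectrum_pauliEig (L : ℕ) : (freqSpectrum pauliEig L).card = 2 * L + 1 := by
  rw [freqSpectrum_pauliEig, card_image_of_injective _ Int.cast_injective, Int.card_Icc]
  have h : (L : ℤ) + 1 - -(L : ℤ) = ((2 * L + 1 : ℕ) : ℤ) := by push_cast; ring
  rw [h, Int.toNat_natCast]

end

end Literature.Computability.QuantumComplexity.DataEncodingSpectrum
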